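import Literature.Analysis.FluidPDE.FluidComputer.ThresholdLevelTableRunX0
import Literature.Analysis.FluidPDE.FluidComputer.ThresholdLevelTableRunX1
import Literature.Analysis.FluidPDE.FluidComputer.ThresholdLevelTableRunX2
import Literature.Analysis.FluidPDE.FluidComputer.ThresholdLevelTableRunX3
import Literature.Analysis.FluidPDE.FluidComputer.ThresholdLevelTableRunX4
import Literature.Analysis.FluidPDE.FluidComputer.ThresholdLevelTableRunX5
import Literature.Analysis.FluidPDE.FluidComputer.ThresholdLevelTableRunX6
import Literature.Analysis.FluidPDE.FluidComputer.ThresholdLevelTableRunX7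
import Literature.Analysis.FluidPDE.FluidComputer.ThresholdLevelCertificate
import HarnessLib

/-!
# Certificate: the transfer stage of the threshold gate, UNIFORMLY over the WIDER box of gate data — all seven data within 1/300 (bp3 gen 13, layer 4: robustness variant X)

HONEST FRAMING: low prior, high value-of-information experiment on Tao's machine paradigm; NOT a
claim that NS blows up.

The design-point certificate `designPoint_transfer_reach` (`ThresholdLevelCertificate.lean`)
made uniform: for EVERY gate datum `G = (ε, σ, ν, μ, r, κ, δ)` in the box `GIx` — each of the six couplings
within relative `1/300` of the design values `ε₀ = 0.2`, `σ₀ ≈ 3.58·10⁻⁴`, `ν₀ = 480`, `μ₀ = 96`,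
`r₀ ≈ 1.1757·10⁴`, `κ₀ = 4800`, and any forcing defect `0 ≤ δ ≤ (1 + 1/300)·δ₀`, `δ₀ ≈ 3.58·10⁻⁶` —
every `δ`-approximate orbit of `thresholdCircuit ε σ ν μ r κ` started in the SAME level-`0` entry
box (`Bc0`: carrier `a ∈ [0.96980, 0.97039]`, clock `b ∈ [0.23043, 0.23057]`, trigger
`c = C₀ ≈ 4.08·10⁻⁴`, slaving residual `κ d z − r c a ∈ [−0.1068, −0.0985]`, output
`z ∈ [0.074850, 0.074895]`, energy `∈ [0.99940, 1.00060]`), continuous on `[0, T₃]`,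
`T₃ = T₃t ≈ 0.20705`, satisfies `x s 4 ^ 2 ≥ EoutX = (1103926740949914462/2^60)² ≈ 0.91681` at
some `s ∈ [0, T₃]` (`dataBoxX_transfer_reach`) — at least `91.68 %` of the entry energy in the
output mode, uniformly on a data box `10/3` times as wide as that of `dataBox_transfer_reach`
(`ThresholdLevelCertificateW.lean`, `10⁻³`, `92.25 %`); the table is UNCHANGED (the margin is
spent, not re-tuned).  Non-vacuity of the entry box: `ThresholdLevelTable.pEntry_mem` there.  Same proof as the design point: the kernel runs
`runX0 … runX31` (`ThresholdLevelTableRunX0 … 7`), `runSteps_append_some`,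
`TableD.rowsValid_of_runSteps` (which quantifies over every real `G ∈ GIx`),
`levelTableStage_reach`.  Sorry-free; standard axioms only.

WHAT THIS IS NOT: stage 3 only, of one gate of the `5`-mode truncated circuit with an abstract
forcing defect; a constant (not yet polynomial-in-anything) robustness margin; not the gate
verdict, not a statement about the averaged or true equations, not evidence for blow-up.
-/

noncomputable section

open Set

namespace Literature.Analysis.FluidPDE.FluidComputer

open Literature.Analysis.FluidPDE.Tao2016AveragedNS

namespace ThresholdLevelTable

/-- The whole data-box table run. [folklore] -/
theorem runX_all : runSteps 60 12 3 GIx RbIt Bc0 stepsT CNt = some Bx32 :=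
  runSteps_append_some 60 12 3 GIx RbIt runX0
    (runSteps_append_some 60 12 3 GIx RbIt runX1
    (runSteps_append_some 60 12 3 GIx RbIt runX2
    (runSteps_append_some 60 12 3 GIx RbIt runX3
    (runSteps_append_some 60 12 3 GIx RbIt runX4
    (runSteps_append_some 60 12 3 GIx RbIt runX5
    (runSteps_append_some 60 12 3 GIx RbIt runX6
    (runSteps_append_some 60 12 3 GIx RbIt runX7
    (runSteps_append_some 60 12 3 GIx RbIt runX8
    (runSteps_append_some 60 12 3 GIx RbIt runX9
    (runSteps_append_some 60 12 3 GIx RbIt runX10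
    (runSteps_append_some 60 12 3 GIx RbIt runX11
    (runSteps_append_some 60 12 3 GIx RbIt runX12
    (runSteps_append_some 60 12 3 GIx RbIt runX13
    (runSteps_append_some 60 12 3 GIx RbIt runX14
    (runSteps_append_some 60 12 3 GIx RbIt runX15
    (runSteps_append_some 60 12 3 GIx RbIt runX16
    (runSteps_append_some 60 12 3 GIx RbIt runX17
    (runSteps_append_some 60 12 3 GIx RbIt runX18
    (runSteps_append_some 60 12 3 GIx RbIt runX19
    (runSteps_append_some 60 12 3 GIx RbIt runX20
    (runSteps_append_some 60 12 3 GIx RbIt runX21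
    (runSteps_append_some 60 12 3 GIx RbIt runX22
    (runSteps_append_some 60 12 3 GIx RbIt runX23
    (runSteps_append_some 60 12 3 GIx RbIt runX24
    (runSteps_append_some 60 12 3 GIx RbIt runX25
    (runSteps_append_some 60 12 3 GIx RbIt runX26
    (runSteps_append_some 60 12 3 GIx RbIt runX27
    (runSteps_append_some 60 12 3 GIx RbIt runX28
    (runSteps_append_some 60 12 3 GIx RbIt runX29
    (runSteps_append_some 60 12 3 GIx RbIt runX30
    (runX31)))))))))))))))))))))))))))))))

/-- The certified output load on the data box, `(zℓ at level 800)² ≈ 0.91681`. [folklore] -/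
def EoutX : ℝ := ((1103926740949914462 : ℝ) / 2 ^ 60) ^ 2

/-- Gate data in the box are admissible (signs). [folklore] -/
theorem valid_of_memX {G : GateData} (hG : GIx.Mem 60 G) : G.Valid :=
  ⟨DI.nonneg_of_nonnegB (I := GIx.ε) (by decide) hG.ε,
    DI.nonneg_of_nonnegB (I := GIx.σ) (by decide) hG.σ,
    DI.nonneg_of_nonnegB (I := GIx.ν) (by decide) hG.ν,
    DI.nonneg_of_nonnegB (I := GIx.μ) (by decide) hG.μ,
    DI.nonneg_of_nonnegB (I := GIx.r) (by decide) hG.r,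
    DI.pos_of_posB (I := GIx.κ) (by decide) hG.κ,
    DI.nonneg_of_nonnegB (I := GIx.δ) (by decide) hG.δ⟩

/-- The real level table generated for the data box. [folklore] -/
def LtX : LevelTable := tableT.toTable 60 12 3 GIx RbIt

/-- Its rows are valid for every gate datum in the box, and the final entry box is `Bx32`.
[folklore] -/
theorem LtX_rowsValid {G : GateData} (hG : GIx.Mem 60 G) :
    LtX.RowsValid G Rbt ∧ tableT.entry 60 12 3 GIx RbIt tableT.steps.length = Bx32 :=
  TableD.rowsValid_of_runSteps (by norm_num) hG RbIt_mem tableT runX_all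

/-- The caps of `LtX` sum to `T₃t` (same steps as `Lt`). [folklore] -/
theorem LtX_time : ∑ k ∈ Finset.range LtX.N, LtX.h k = T₃t := Lt_time

/-- The level-`0` entry box and level are those of the design-point table. [folklore] -/
theorem LtX_B_zero : LtX.B 0 = Lt.B 0 ∧ LtX.C 0 = Lt.C 0 := ⟨rfl, rfl⟩

/-- Energy confinement margin, uniformly in `δ ≤ (1 + 1/300) δ₀`. [folklore] -/
theorem LtX_energy {G : GateData} (hG : GIx.Mem 60 G) :
    ∀ q ∈ {q | (LtX.B 0).mem G.κ G.r (LtX.C 0) q}, energy q + 10 * (G.δ * Rbt) * T₃t < Rbt ^ 2 := by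
  intro q hq
  have hEh : energy q ≤ ((1153613361157173206 : ℤ) : ℝ) / 2 ^ 60 := hq.2.2.2.2.2.2
  have hδ : G.δ * 2 ^ 60 ≤ ((4138572614789 : ℤ) : ℝ) := hG.δ.2
  have hnum : ((1153613361157173206 : ℤ) : ℝ) / 2 ^ 60 +
      10 * ((((4138572614789 : ℤ) : ℝ) / 2 ^ 60) * Rbt) * T₃t < Rbt ^ 2 := by
    norm_num [Rbt, T₃t]
  have hRb : (0 : ℝ) < Rbt := by norm_num [Rbt]
  have hT : (0 : ℝ) < T₃t := by norm_num [T₃t]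
  have hδ' : G.δ ≤ ((4138572614789 : ℤ) : ℝ) / 2 ^ 60 := by
    rw [le_div_iff₀ (by positivity)]; exact hδ
  have hmono : 10 * (G.δ * Rbt) * T₃t ≤ 10 * ((((4138572614789 : ℤ) : ℝ) / 2 ^ 60) * Rbt) * T₃t := by
    have := mul_le_mul_of_nonneg_right hδ' hRb.le
    nlinarith
  linarith

/-- The final entry box certifies the output load. [folklore] -/
theorem LtX_exit {G : GateData} (hG : GIx.Mem 60 G) :
    ∀ X, (LtX.B LtX.N).mem G.κ G.r (LtX.C LtX.N) X → EoutX ≤ X 4 ^ 2 := by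
  intro X hX
  have hB : LtX.B LtX.N = Bx32.toReal 60 := by
    show (tableT.entry 60 12 3 GIx RbIt tableT.steps.length).toReal 60 = _
    rw [(LtX_rowsValid hG).2]
  rw [hB] at hX
  have hz : ((1103926740949914462 : ℤ) : ℝ) / 2 ^ 60 ≤ X 4 := hX.2.2.2.2.1.1
  have h0 : (0 : ℝ) ≤ ((1103926740949914462 : ℤ) : ℝ) / 2 ^ 60 := by positivity
  calc EoutX = (((1103926740949914462 : ℤ) : ℝ) / 2 ^ 60) ^ 2 := by norm_num [EoutX]
    _ ≤ X 4 ^ 2 := pow_le_pow_left₀ h0 hz 2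

/-- The stage-3 reach certificate of the assembly interface, for every gate datum in the box.
[folklore] -/
def dataBoxX_transferStage {G : GateData} (hG : GIx.Mem 60 G) :
    ReachCertificate (thresholdCircuit G.ε G.σ G.ν G.μ G.r G.κ) (modeBall Rbt) G.δ T₃t
      {q | (LtX.B 0).mem G.κ G.r (LtX.C 0) q} (outputLoaded EoutX) :=
  levelTableStage G (valid_of_memX hG) Rbt T₃t EoutX LtX _ (by norm_num [Rbt]) (LtX_rowsValid hG).1
    LtX_time.le (LtX_energy hG) (fun _ hq => hq) (LtX_exit hG)

/-- THE UNIFORM CERTIFICATE.  For every gate datum `G` in the box `GIx` (all six couplings within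
relative `1/300` of the design point, `0 ≤ δ ≤ (1 + 1/300) δ₀`), every `G.δ`-approximate orbit of the
threshold circuit started in the level-`0` entry box loads the output mode to
`x s 4 ^ 2 ≥ EoutX ≈ 0.91681` at some time `s ≤ T₃t ≈ 0.20705`.
[cite: Tao2016AveragedNS, §5.5 Thm 5.3 (5.5)] -/
theorem dataBoxX_transfer_reach {G : GateData} (hG : GIx.Mem 60 G) {p : Fin 5 → ℝ}
    (hp : (LtX.B 0).mem G.κ G.r (LtX.C 0) p) {x : ℝ → Fin 5 → ℝ} (hx0 : x 0 = p)
    (hcont : ContinuousOn x (Icc 0 T₃t))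
    (hder : ∀ s ∈ Ico 0 T₃t, ∃ W : Fin 5 → ℝ, HasDerivWithinAt x W (Ici s) s ∧
      ‖W - thresholdCircuit G.ε G.σ G.ν G.μ G.r G.κ (x s)‖ ≤ G.δ) :
    ∃ s ∈ Icc 0 T₃t, EoutX ≤ x s 4 ^ 2 :=
  levelTableStage_reach G (valid_of_memX hG) Rbt T₃t EoutX LtX
    {q | (LtX.B 0).mem G.κ G.r (LtX.C 0) q} (by norm_num [Rbt]) (LtX_rowsValid hG).1 LtX_time.le
    (by norm_num [T₃t]) (LtX_energy hG) (fun _ hq => hq) (LtX_exit hG) hp hx0 hcont hder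

/-- The design point itself lies in the box. [folklore] -/
theorem Gt_memX : GIx.Mem 60 Gt :=
  ⟨by norm_num [DI.mem, GIx, Gt], by norm_num [DI.mem, GIx, Gt], by norm_num [DI.mem, GIx, Gt],
    by norm_num [DI.mem, GIx, Gt], by norm_num [DI.mem, GIx, Gt], by norm_num [DI.mem, GIx, Gt],
    by norm_num [DI.mem, GIx, Gt]⟩

end ThresholdLevelTable

end Literature.Analysis.FluidPDE.FluidComputer

end
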